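import Literature.Analysis.FluidPDE.LerayProfileCalculus
import Literature.Analysis.FluidPDE.TsaiHeadPressure
import Literature.Analysis.FluidPDE.TsaiGrowthLemmas
import Literature.Analysis.FluidPDE.TsaiLocalEnergy
import Literature.Analysis.FluidPDE.TsaiMaximumPrinciple
import Literature.Analysis.FluidPDE.HarmonicLiouvilleLp
import HarnessLib

/-!
# The endgame of Tsai's Liouville theorems for Leray profiles (Tsai 1998, §5): identity (1.7),
  `Π` constant ⟹ `ΔU = 0`, and Theorems 1–2 from the lemmas of §§2–4

Analysis/FluidPDE proofs layer for the named facts `Literature.Analysis.FluidPDE.tsai_selfsimilar`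
(Tsai 1998, **Theorem 1**) and `Literature.Analysis.FluidPDE.tsai_selfsimilar_local_energy`
(Tsai 1998, **Theorem 2**) of `FluidPDE/SelfSimilarLiouville` (T.-P. Tsai, *On Leray's self-similar
solutions of the Navier–Stokes equations satisfying local energy estimates*, Arch. Rational
Mech. Anal. 143 (1998) 29–51).

## The printed proof (Tsai 1998, §5, pp. 47–49) and what this file does

For a profile `(U, P)` of Leray's system (1.3), `−νΔU + aU + a(y·∇)U + (U·∇)U + ∇P = 0`,
`div U = 0` (the accepted pointwise class `IsLerayProfile ν a U P`), the *head pressure*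
`Π = ½|U|² + P + a y·U` satisfies (1.7): `−νΔΠ + (U + ay)·∇Π = −ν|Ω|² ≤ 0`, `Ω = curl U`
(Nečas–Růžička–Šverák). "Proofs of Theorems 1 and 2" (p. 48): the growth estimates
`U(y) = o(|y|)`, `Π(y) = O(|y|^N)` (Lemmas 3.2–3.3 for Theorem 1; Corollary 4.3 and (4.4) for
Theorem 2) and the Liouville-type Lemma 5.1 make `Π` constant; then `∇Π = 0`, (1.7) gives
`|Ω|² = 0`, and comparing `∇Π = 0` with (1.3) gives `−νΔUᵢ = 0`; since `U ∈ L^q` (Theorem 1) or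
`U → 0` (Theorem 2), the Liouville theorem for harmonic functions gives `U ≡ 0`. Theorem 2 may
also be finished by "the first way" (p. 47): Corollary 4.3 puts `U` in `L^q`, `q > 3`, and
Theorem 1 applies.

This file **proves** the whole of §5 for the pointwise class and assembles both theorems from
the analytic lemmas of §§2–4, which are the named facts of `TsaiGrowthLemmas`
(`tsai1998_profile_smooth`, `tsai1998_lemma32`, `tsai1998_lemma33`; landed by the Theorem 1 line
of work) and of `TsaiLocalEnergy` (`tsai1998_lemma41`, `tsai1998_lemma42`):

* for the head pressure `headPressure a U P` (`Π`, defined in `TsaiHeadPressure`), its gradient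
  and Laplacian in coordinate-free form, and **(1.7)** in the sharp form
  `ν ΔΠ − DΠ[U + a y] = (ν/2) |DU − DUᵀ|²` (`IsLerayProfile.driftOp_headPressure_eq_spin`; on `ℝ³`,
  `½|DU − DUᵀ|² = |curl U|²`), on any finite-dimensional inner product space and for `U ∈ C³`,
  `P ∈ C²` — by the pressure Poisson equation `ΔP = −tr (DU∘DU)`, `Δ½|U|² = ⟪ΔU, U⟫ + |DU|²`,
  `Δ(a y·U) = a y·ΔU` and the system paired with `U + a y` (`LerayProfileCalculus`); hence
  `LΠ ≥ 0` for Tsai's drift operator `L = νΔ − (U + ay)·∇` (`driftOp`, `TsaiMaximumPrinciple`).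
(`TsaiHeadPressure`/`TsaiHeadPressureIdentity` prove (1.7) and `Π const ⟹ ΔU = 0` in the
  coordinates of `ℝ^ι` for profiles with *smooth* velocity — `IsLerayProfile.driftOp_headPressure`,
  `IsLerayProfile.laplacian_eq_zero_of_headPressure_const` —; the versions here,
  `IsLerayProfile.driftOp_headPressure_eq_spin` and
  `IsLerayProfile.laplacian_eq_zero_of_headPressure_const_of_contDiff`, are coordinate-free, hold
  on any finite-dimensional inner product space under `U ∈ C³`, `P ∈ C²`, identify the right-hand
  side as `(ν/2)|spin U|²`, and are proved independently, using only `headPressure_apply` from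
  those files.)
* `IsLerayProfile.laplacian_eq_zero_of_headPressure_const_of_contDiff`: if `Π` is constant then `ΔU ≡ 0`
  (`LΠ = 0` forces `DU = DUᵀ` by `tr (L²) ≤ |L|²` with equality iff symmetric; then
  `∇Π = DUᵀ(U + ay) + aU + ∇P = 0` and (1.3) reads `νΔU = DU(U + ay) + aU + ∇P = 0`).
* `IsLerayProfile.eq_zero_of_growth` — **the endgame**, on any nontrivial finite-dimensional
  inner product space (Remark 5.2): `ν > 0`, `a > 0`, `U ∈ C³`, `P ∈ C²`, `|U(y)| ≤ b|y|` for
  `|y| ≥ r₀` with some `b < a`, `|P(y)| ≤ C|y|^N` for `|y| ≥ R`, and `U ∈ L^q` for some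
  `1 ≤ q < ∞` imply `U ≡ 0` (polynomial growth of `Π`, the proved Lemma 5.1
  `isConst_of_driftOp_nonneg_of_poly`, the previous item, and the proved Liouville theorem
  `eq_zero_of_harmonic_memLp_inner`).
* Assemblies (inputs: `tsai1998_profile_smooth` — p. 33, weak solutions of (1.3) are smooth —,
  `tsai1998_lemma33` — `U ∈ L^q`, `3 < q < ∞` ⟹ `U = o(|y|)` —, `tsai1998_lemma32` — `U ∈ L^q`,
  `3 ≤ q ≤ ∞` ⟹ `P = O(|y|^N)` —, `tsai1998_lemma41`, `tsai1998_lemma42`): `tsai_selfsimilar_of_growth_lemmas : tsai1998_profile_smooth → tsai1998_lemma33 →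
  tsai1998_lemma32 → tsai_selfsimilar` (Theorem 1); `tsai_selfsimilar_local_energy_of_growth_lemmas`
  (Theorem 2 from the same three facts plus `tsai1998_lemma41`, `tsai1998_lemma42`, through the
  tree's `tsai_selfsimilar_local_energy_of_lemmas`); and the shorter
  `tsai_selfsimilar_local_energy_of_lemma32 : tsai1998_profile_smooth → tsai1998_lemma32 →
  tsai1998_lemma41 → tsai1998_lemma42 → tsai_selfsimilar_local_energy`, which bypasses Theorem 1
  and Lemma 3.3: the proved Corollary 4.3 (`tsai1998_corollary43`, `TsaiLocalEnergy`) already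
  gives `|U(y)| ≤ C/|y|`, stronger than `o(|y|)`, and `U ∈ L⁴(ℝ³)`.

So the remaining inputs of `tsai_selfsimilar_local_energy` are exactly: interior regularity for
(1.3) (`tsai1998_profile_smooth`), the polynomial pressure growth Lemma 3.2 (Calderón–Zygmund /
BMO bounds for `RᵢRⱼ(UᵢUⱼ)` and interior `L^p` estimates for the Stokes system), Lemma 4.1
(`A_p`-weighted Riesz transforms, suitability) and Lemma 4.2 (Caffarelli–Kohn–Nirenberg's
Proposition 2, backward form); once these are discharged, `tsai_selfsimilar_local_energy_holds`
is `tsai_selfsimilar_local_energy_of_lemma32` applied to their `_holds` theorems.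

## Design notes

* **Regularity.** The accepted class has `U ∈ C²`, `P ∈ C¹`, for which `Π` is only `C¹` and
  (1.7) has no classical meaning (`ΔP` requires `div ΔU = Δ div U`, three derivatives of `U`).
  In print `U` is smooth by elliptic regularity (p. 33); here the identities carry the honest
  hypotheses `U ∈ C³`, `P ∈ C²`, the regularity is the named fact `tsai1998_profile_smooth`
  (`U ∈ C^∞`, as printed; `TsaiGrowthLemmas`), and `P ∈ C²` is then *proved*
  (`IsLerayProfile.contDiff_two_pressure`, `LerayProfileCalculus`; the `C^∞` version is
  `IsLerayProfile.contDiff_pressure_of_smooth` of `TsaiHeadPressure`).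
* **Lemma 5.1's growth hypothesis** is used in the corrected form proved in
  `TsaiMaximumPrinciple` (polynomial growth suffices; see that file for why the printed
  `o(∫ e^{cs²/2})` is too generous); Tsai's application is polynomial, so nothing is lost.
* **`o(|y|)` versus `b|y|`.** The endgame only needs `|U(y)| ≤ b|y|` near infinity for *some*
  `b < a` (Remark 5.3); Lemma 3.3's `o(|y|)` is applied with `ε = a/2`.
* **The pressure in Lemma 3.2.** Tsai's `P` is "defined as in Section 2" (the locally defined
  Stokes pressure, glued and normalised; unique up to a constant); in the pointwise class `P` is
  part of the data, `C¹` with (1.3) holding pointwise, hence such a pressure up to an additive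
  constant, which does not affect `O(|y|^N)`.

## Mathlib / tree search

No Navier–Stokes, Leray system, Riesz transform, Stokes-estimate or elliptic-regularity theory in
Mathlib (this pin; `lean search 'Riesz transform'`, `'Stokes'`, `'elliptic regularity'` find tree
docstrings only). Used from the tree: `IsLerayProfile`, `headPressure` (`TsaiHeadPressure`),
the three facts of `TsaiGrowthLemmas`, `driftOp`, `isConst_of_driftOp_nonneg_of_poly` (Lemma 5.1),
`eq_zero_of_harmonic_memLp_inner`, `harmonicOnNhd_of_laplacian_eq_zero`, `tsai1998_corollary43`,
`memLp_of_norm_mul_norm_le`, `tsai1998_top_singular_null_of_lemma42`,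
`tsai_selfsimilar_local_energy_of_lemmas`, and the identities of `LerayProfileCalculus`. No new
definitions or named facts are introduced here.

## References

* T.-P. Tsai, *On Leray's self-similar solutions of the Navier–Stokes equations satisfying local
  energy estimates*, Arch. Rational Mech. Anal. 143 (1998) 29–51: Theorems 1–2 (p. 31), (1.7)
  (p. 31), §2 (pp. 33–34), Lemma 3.2 (p. 39), Lemma 3.3 (p. 40), Corollary 4.3 and "the first way"
  (p. 47), Lemma 5.1, Remarks 5.2–5.3 and the proofs of Theorems 1 and 2 (pp. 47–49) [Tsai1998].
* J. Nečas, M. Růžička, V. Šverák, *On Leray's self-similar solutions of the Navier–Stokes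
  equations*, Acta Math. 176 (1996) 283–294, (2.9)–(2.11) and §2 (regularity)
  [NecasRuzickaSverak1996].
-/

noncomputable section

open MeasureTheory Set Function Filter Topology InnerProductSpace Metric
open scoped RealInnerProductSpace Laplacian ContDiff NNReal ENNReal

namespace Literature.Analysis.FluidPDE

/-! ## The head pressure and identity (1.7) -/

section HeadPressure

variable {E : Type*} [NormedAddCommGroup E] [InnerProductSpace ℝ E] [FiniteDimensional ℝ E]

omit [FiniteDimensional ℝ E] in
/-- The head pressure `Π = ½|U|² + P + a y·U` of `TsaiHeadPressure` (`headPressure a U P`),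
written with `|U|² = ⟪U, U⟫`. [cite: Tsai1998, (1.7) (p. 31)] -/
theorem headPressure_apply_inner (a : ℝ) (U : E → E) (P : E → ℝ) (y : E) :
    headPressure a U P y = 2⁻¹ * ⟪U y, U y⟫ + P y + a * ⟪y, U y⟫ := by
  rw [headPressure_apply, real_inner_self_eq_norm_sq]

omit [FiniteDimensional ℝ E] in
/-- `Π = ½⟪U, U⟫ + P + a ⟪·, U⟫` as a sum of functions. [folklore] -/
theorem headPressure_eq_add (a : ℝ) (U : E → E) (P : E → ℝ) :
    headPressure a U P = ((2⁻¹ : ℝ) • fun y => ⟪U y, U y⟫) + P + (a • fun y => ⟪y, U y⟫) := by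
  funext y
  rw [headPressure_apply_inner]
  simp [smul_eq_mul]

omit [FiniteDimensional ℝ E] in
/-- `Π` is `Cⁿ` when `U` and `P` are. [folklore] -/
theorem contDiff_headPressure {a : ℝ} {U : E → E} {P : E → ℝ} {n : ℕ∞} (hU : ContDiff ℝ n U)
    (hP : ContDiff ℝ n P) : ContDiff ℝ n (headPressure a U P) := by
  have hfun : headPressure a U P = fun y => 2⁻¹ * ⟪U y, U y⟫ + P y + a * ⟪y, U y⟫ :=
    funext (headPressure_apply_inner a U P)
  rw [hfun]
  exact ((contDiff_const.mul (hU.inner ℝ hU)).add hP).add (contDiff_const.mul (contDiff_id.inner ℝ hU))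

omit [FiniteDimensional ℝ E] in
/-- **Gradient of the head pressure**: `DΠ(y) w = ⟪U, DU w⟫ + DP w + a (⟪w, U⟫ + ⟪y, DU w⟫)`. [folklore] -/
theorem fderiv_headPressure_apply {a : ℝ} {U : E → E} {P : E → ℝ} (hU : Differentiable ℝ U)
    (hP : Differentiable ℝ P) (y w : E) :
    fderiv ℝ (headPressure a U P) y w =
      ⟪U y, fderiv ℝ U y w⟫ + fderiv ℝ P y w + a * (⟪w, U y⟫ + ⟪y, fderiv ℝ U y w⟫) := by
  have hfun : headPressure a U P = fun y => 2⁻¹ * ⟪U y, U y⟫ + P y + a * ⟪y, U y⟫ :=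
    funext (headPressure_apply_inner a U P)
  rw [hfun]
  have hid : DifferentiableAt ℝ (fun y : E => y) y := differentiableAt_fun_id
  have h1 : DifferentiableAt ℝ (fun y => 2⁻¹ * ⟪U y, U y⟫) y := ((hU y).inner ℝ (hU y)).const_mul _
  have h2 : DifferentiableAt ℝ (fun y => 2⁻¹ * ⟪U y, U y⟫ + P y) y := h1.add (hP y)
  have h3 : DifferentiableAt ℝ (fun y => a * ⟪y, U y⟫) y := (hid.inner ℝ (hU y)).const_mul _
  rw [fderiv_fun_add h2 h3, fderiv_fun_add h1 (hP y), fderiv_const_mul ((hU y).inner ℝ (hU y)),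
    fderiv_const_mul (hid.inner ℝ (hU y))]
  simp only [_root_.add_apply, FunLike.coe_smul, Pi.smul_apply, smul_eq_mul]
  rw [fderiv_inner_apply ℝ (hU y) (hU y), fderiv_inner_apply ℝ hid (hU y), fderiv_fun_id]
  simp only [ContinuousLinearMap.coe_id', id_eq]
  rw [real_inner_comm (U y) (fderiv ℝ U y w)]
  ring

/-- **Laplacian of the head pressure**:
`ΔΠ = ⟪ΔU, U⟫ + |DU|² + ΔP + a (⟪y, ΔU⟫ + 2 div U)`. [folklore] -/
theorem laplacian_headPressure {a : ℝ} {U : E → E} {P : E → ℝ} (hU : ContDiff ℝ 2 U)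
    (hP : ContDiff ℝ 2 P) (x : E) :
    (Δ (headPressure a U P)) x =
      ⟪(Δ U) x, U x⟫ + frobeniusNormSq (fderiv ℝ U x) + (Δ P) x +
        a * (⟪x, (Δ U) x⟫ + 2 * VectorCalculus.divergence U x) := by
  have h1 : ContDiff ℝ 2 fun y => ⟪U y, U y⟫ := hU.inner ℝ hU
  have h3 : ContDiff ℝ 2 fun y : E => ⟪y, U y⟫ := contDiff_id.inner ℝ hU
  have h1' : ContDiff ℝ 2 ((2⁻¹ : ℝ) • fun y => ⟪U y, U y⟫) := contDiff_const.smul h1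
  have h3' : ContDiff ℝ 2 (a • fun y : E => ⟪y, U y⟫) := contDiff_const.smul h3
  have h12 : ContDiff ℝ 2 (((2⁻¹ : ℝ) • fun y => ⟪U y, U y⟫) + P) := h1'.add hP
  rw [headPressure_eq_add, h12.contDiffAt.laplacian_add h3'.contDiffAt,
    h1'.contDiffAt.laplacian_add hP.contDiffAt, laplacian_smul _ h1.contDiffAt,
    laplacian_smul _ h3.contDiffAt, laplacian_inner_self_eq hU, laplacian_inner_id_eq hU]
  simp only [smul_eq_mul]
  ring

/-- **Tsai 1998, (1.7)** (Nečas–Růžička–Šverák 1996, (2.10)), coordinate-free on any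
finite-dimensional inner product space: for a Leray profile `(U, P)` with `U ∈ C³`, `P ∈ C²`, the
head pressure `Π = ½|U|² + P + a y·U` satisfies `ν ΔΠ − (U + a y)·∇Π = (ν/2) |DU − DUᵀ|²`
(`spin U = DU − DUᵀ`; `½|DU − DUᵀ|² = |curl U|²` on `ℝ³`), i.e. `−νΔΠ + (U + a y)·∇Π = −ν|Ω|² ≤ 0`.
(Generalises the coordinate identity `IsLerayProfile.driftOp_headPressure` of
`TsaiHeadPressureIdentity`, stated on `ℝ^ι` for smooth `U`.) [cite: Tsai1998, (1.7) (p. 31)] -/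
theorem IsLerayProfile.driftOp_headPressure_eq_spin {ν a : ℝ} {U : E → E} {P : E → ℝ}
    (h : IsLerayProfile ν a U P) (hU3 : ContDiff ℝ 3 U) (hP2 : ContDiff ℝ 2 P) (y : E) :
    driftOp ν a U (headPressure a U P) y = ν / 2 * frobeniusNormSq (spin U y) := by
  haveI : CompleteSpace E := FiniteDimensional.complete ℝ E
  have hU2 : ContDiff ℝ 2 U := hU3.of_le (by norm_num)
  have hU1 : ContDiff ℝ 1 U := hU3.of_le (by norm_num)
  have hUd : Differentiable ℝ U := hU1.differentiable one_ne_zero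
  have hPd : Differentiable ℝ P := (hP2.of_le one_le_two).differentiable one_ne_zero
  have hΔP := h.laplacian_pressure_eq hU3 hP2 y
  have hLapHead := laplacian_headPressure (a := a) hU2 hP2 y
  have hDerHead := fderiv_headPressure_apply (a := a) hUd hPd y (U y + a • y)
  have hEU : ⟪-(ν • (Δ U) y) + a • U y + a • fderiv ℝ U y y + convect U U y + gradient P y, U y⟫ = 0 := by
    rw [h.profile_eq y, inner_zero_left]
  have hEy : ⟪-(ν • (Δ U) y) + a • U y + a • fderiv ℝ U y y + convect U U y + gradient P y, y⟫ = 0 := by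
    rw [h.profile_eq y, inner_zero_left]
  simp only [inner_add_left, inner_neg_left, real_inner_smul_left, convect_apply, gradient,
    InnerProductSpace.toDual_symm_apply] at hEU hEy
  have hspin : frobeniusNormSq (spin U y) =
      2 * (frobeniusNormSq (fderiv ℝ U y) - traceCLM ((fderiv ℝ U y).comp (fderiv ℝ U y))) :=
    frobeniusNormSq_sub_adjoint _
  rw [driftOp, hLapHead, hDerHead, hΔP, h.divFree y, hspin, map_add, map_smul, map_add, map_smul]
  simp only [inner_add_right, inner_add_left, real_inner_smul_right, real_inner_smul_left,
    smul_eq_mul]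
  set L : E := (Δ U : E → E) y with hL
  rw [real_inner_comm (U y) (fderiv ℝ U y y), real_inner_comm (U y) (fderiv ℝ U y (U y))] at hEU
  rw [real_inner_comm y L, real_inner_comm y (U y), real_inner_comm y (fderiv ℝ U y y),
    real_inner_comm y (fderiv ℝ U y (U y))] at hEy
  linear_combination (-1 : ℝ) * hEU - a * hEy

/-- **NRŠ identity (2.11) / Tsai's inequality (5.1)**: the head pressure of a Leray profile
(`U ∈ C³`, `P ∈ C²`, `ν ≥ 0`, any finite-dimensional inner product space) is a subsolution of the
drift–Laplace operator, `ν ΔΠ − (U + a y)·∇Π ≥ 0` (cf. `IsLerayProfile.driftOp_headPressure_nonneg`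
of `TsaiHeadPressureIdentity` for smooth `U` on `ℝ^ι`). [cite: Tsai1998, (1.7) and (5.1)] -/
theorem IsLerayProfile.driftOp_headPressure_nonneg_of_contDiff {ν a : ℝ} {U : E → E} {P : E → ℝ}
    (h : IsLerayProfile ν a U P) (hν : 0 ≤ ν) (hU3 : ContDiff ℝ 3 U) (hP2 : ContDiff ℝ 2 P) (y : E) :
    0 ≤ driftOp ν a U (headPressure a U P) y := by
  rw [h.driftOp_headPressure_eq_spin hU3 hP2 y]
  exact mul_nonneg (by positivity) (frobeniusNormSq_nonneg _)

/-- **The endgame of Tsai's proof, first half** (Tsai 1998, p. 48: "`Π` is constant. Therefore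
`∇Π` is zero … if we consider (1.7), we get `|Ω(y)|² = 0` … Comparing (5.2) with the equations
(1.3) of `U` we get `−νΔUᵢ = 0` for each `i`"). If the head pressure of a Leray profile
(`U ∈ C³`, `P ∈ C²`, `ν ≠ 0`, any finite-dimensional inner product space) is constant, then `U`
is harmonic: `ΔU ≡ 0` (cf. `IsLerayProfile.laplacian_eq_zero_of_headPressure_const` of
`TsaiHeadPressureIdentity` for smooth `U` on `ℝ^ι`). [cite: Tsai1998, p. 48 (proofs of Theorems 1 and 2)] -/
theorem IsLerayProfile.laplacian_eq_zero_of_headPressure_const_of_contDiff {ν a : ℝ} {U : E → E} {P : E → ℝ}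
    (h : IsLerayProfile ν a U P) (hν : ν ≠ 0) (hU3 : ContDiff ℝ 3 U) (hP2 : ContDiff ℝ 2 P)
    (hconst : ∀ x y, headPressure a U P x = headPressure a U P y) (y : E) : (Δ U) y = 0 := by
  haveI : CompleteSpace E := FiniteDimensional.complete ℝ E
  have hU1 : ContDiff ℝ 1 U := hU3.of_le (by norm_num)
  have hUd : Differentiable ℝ U := hU1.differentiable one_ne_zero
  have hPd : Differentiable ℝ P := (hP2.of_le one_le_two).differentiable one_ne_zero
  have hHead : headPressure a U P = fun _ => headPressure a U P 0 := funext fun x => hconst x 0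
  have hD0 : ∀ w, fderiv ℝ (headPressure a U P) y w = 0 := fun w => by
    rw [hHead]
    simp
  have hΔ0 : (Δ (headPressure a U P)) y = 0 := by
    rw [hHead]
    exact laplacian_const_eq_zero _ _
  have hdrift : driftOp ν a U (headPressure a U P) y = 0 := by
    rw [driftOp, hΔ0, hD0, mul_zero, sub_zero]
  -- `|DU - DUᵀ|² = 0`: the velocity gradient is symmetric
  have hspin : frobeniusNormSq (spin U y) = 0 := by
    have := h.driftOp_headPressure_eq_spin hU3 hP2 y
    rw [hdrift] at this
    exact ((mul_eq_zero.1 this.symm).resolve_left (div_ne_zero hν two_ne_zero))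
  have htr : traceCLM ((fderiv ℝ U y).comp (fderiv ℝ U y)) = frobeniusNormSq (fderiv ℝ U y) := by
    have := frobeniusNormSq_sub_adjoint (fderiv ℝ U y)
    change frobeniusNormSq (fderiv ℝ U y - ContinuousLinearMap.adjoint (fderiv ℝ U y)) = 0 at hspin
    linarith
  have hsymm : ∀ v w, ⟪fderiv ℝ U y v, w⟫ = ⟪v, fderiv ℝ U y w⟫ :=
    inner_map_comm_of_traceCLM_comp_self_eq htr
  -- `∇Π(y) = 0`
  have hDw : ∀ w, ⟪U y, fderiv ℝ U y w⟫ + fderiv ℝ P y w + a * (⟪w, U y⟫ + ⟪y, fderiv ℝ U y w⟫) = 0 :=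
    fun w => by rw [← fderiv_headPressure_apply hUd hPd y w]; exact hD0 w
  -- pair the profile equation with `w = ΔU(y)`
  have hEw : ⟪-(ν • (Δ U) y) + a • U y + a • fderiv ℝ U y y + convect U U y + gradient P y, (Δ U) y⟫ = 0 := by
    rw [h.profile_eq y, inner_zero_left]
  simp only [inner_add_left, inner_neg_left, real_inner_smul_left, convect_apply, gradient,
    InnerProductSpace.toDual_symm_apply] at hEw
  set L : E := (Δ U : E → E) y with hL
  have h1 := hsymm (U y) L
  have h2 := hsymm y L
  have h3 := hDw L
  rw [real_inner_comm (U y) L] at h3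
  have key : ν * ⟪L, L⟫ = 0 := by linear_combination (-1 : ℝ) * hEw + h3 + h1 + a * h2
  rcases mul_eq_zero.1 key with hν0 | hww
  · exact absurd hν0 hν
  · exact inner_self_eq_zero.1 hww

end HeadPressure

/-! ## The endgame -/

section Endgame

variable {E : Type*} [NormedAddCommGroup E] [InnerProductSpace ℝ E] [FiniteDimensional ℝ E]

omit [FiniteDimensional ℝ E] in
/-- **Polynomial growth of the head pressure** from an affine bound on `U` and a polynomial bound
on `P`: `|Π(y)| ≤ K (1 + |y|)^{N+2}` (Tsai 1998, p. 48: "`U(y) = o(|y|)`, `Π(y) = O(|y|^N)`").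
[cite: Tsai1998, p. 48 (proofs of Theorems 1 and 2)] -/
theorem abs_headPressure_le {a b M C : ℝ} {N : ℕ} {U : E → E} {P : E → ℝ} (ha : 0 ≤ a)
    (hb : 0 ≤ b) (hM : 0 ≤ M) (hC : 0 ≤ C) (hU : ∀ y, ‖U y‖ ≤ M + b * ‖y‖)
    (hP : ∀ y, |P y| ≤ C * (1 + ‖y‖) ^ N) (y : E) :
    |headPressure a U P y| ≤ (2⁻¹ * (M + b) ^ 2 + C + a * (M + b)) * (1 + ‖y‖) ^ (N + 2) := by
  set t := 1 + ‖y‖ with ht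
  have ht1 : 1 ≤ t := by rw [ht]; linarith [norm_nonneg y]
  have ht0 : 0 ≤ t := zero_le_one.trans ht1
  have hyt : ‖y‖ ≤ t := by rw [ht]; linarith
  have hUt : ‖U y‖ ≤ (M + b) * t := by
    calc ‖U y‖ ≤ M + b * ‖y‖ := hU y
      _ ≤ (M + b) * t := by rw [ht]; nlinarith [norm_nonneg y]
  have htN : t ^ N ≤ t ^ (N + 2) := pow_le_pow_right₀ ht1 (by omega)
  have ht2 : t ^ 2 ≤ t ^ (N + 2) := pow_le_pow_right₀ ht1 (by omega)
  have hMb : 0 ≤ M + b := by positivity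
  have h1 : |2⁻¹ * ⟪U y, U y⟫| ≤ 2⁻¹ * (M + b) ^ 2 * t ^ (N + 2) := by
    rw [abs_mul, abs_of_pos (by norm_num : (0 : ℝ) < 2⁻¹), real_inner_self_eq_norm_sq,
      abs_of_nonneg (sq_nonneg _)]
    have hsq : ‖U y‖ ^ 2 ≤ ((M + b) * t) ^ 2 := pow_le_pow_left₀ (norm_nonneg _) hUt 2
    have : ((M + b) * t) ^ 2 ≤ (M + b) ^ 2 * t ^ (N + 2) := by
      rw [mul_pow]
      exact mul_le_mul_of_nonneg_left ht2 (sq_nonneg _)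
    nlinarith
  have h2 : |P y| ≤ C * t ^ (N + 2) := (hP y).trans (mul_le_mul_of_nonneg_left htN hC)
  have h3 : |a * ⟪y, U y⟫| ≤ a * (M + b) * t ^ (N + 2) := by
    rw [abs_mul, abs_of_nonneg ha]
    calc a * |⟪y, U y⟫| ≤ a * (‖y‖ * ‖U y‖) := by gcongr; exact abs_real_inner_le_norm _ _
      _ ≤ a * (t * ((M + b) * t)) := by gcongr
      _ = a * (M + b) * t ^ 2 := by ring
      _ ≤ a * (M + b) * t ^ (N + 2) := mul_le_mul_of_nonneg_left ht2 (by positivity)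
  calc |headPressure a U P y| = |2⁻¹ * ⟪U y, U y⟫ + P y + a * ⟪y, U y⟫| := by
        rw [headPressure_apply_inner]
    _ ≤ |2⁻¹ * ⟪U y, U y⟫| + |P y| + |a * ⟪y, U y⟫| := abs_add_three _ _ _
    _ ≤ 2⁻¹ * (M + b) ^ 2 * t ^ (N + 2) + C * t ^ (N + 2) + a * (M + b) * t ^ (N + 2) := by
        linarith
    _ = (2⁻¹ * (M + b) ^ 2 + C + a * (M + b)) * t ^ (N + 2) := by ring

variable [MeasurableSpace E] [BorelSpace E] [Nontrivial E]

/-- **The endgame of Tsai's proof** (Tsai 1998, §5, pp. 48–49, "Proofs of Theorems 1 and 2"),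
on any nontrivial finite-dimensional real inner product space (Tsai: `ℝ³`; Remark 5.2: `ℝⁿ`).
Let `ν > 0`, `a > 0`, let `(U, P)` solve Leray's profile system with `U ∈ C³`, `P ∈ C²`, and
assume the growth estimates `|U(y)| ≤ b|y|` for `|y| ≥ r₀` with some `b < a` (Tsai:
`U(y) = o(|y|)`) and `|P(y)| ≤ C|y|^N` for `|y| ≥ R` (Tsai: `P(y) = O(|y|^N)`), and `U ∈ L^q` for
some `1 ≤ q < ∞`. Then `U ≡ 0`. Proof: the head pressure `Π = ½|U|² + P + a y·U` is `C²`,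
polynomially bounded (`abs_headPressure_le`) and satisfies `νΔΠ − (U + ay)·∇Π ≥ 0` ((1.7),
`IsLerayProfile.driftOp_headPressure_nonneg_of_contDiff`), so it is constant by the Liouville-type
Lemma 5.1 (`isConst_of_driftOp_nonneg_of_poly`); hence `ΔU ≡ 0`
(`IsLerayProfile.laplacian_eq_zero_of_headPressure_const_of_contDiff`), and a harmonic `L^q` field vanishes
(`eq_zero_of_harmonic_memLp_inner`). [cite: Tsai1998, §5 (pp. 48–49, proofs of Theorems 1 and 2)] -/
theorem IsLerayProfile.eq_zero_of_growth {ν a : ℝ} (hν : 0 < ν) (ha : 0 < a) {U : E → E}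
    {P : E → ℝ} (h : IsLerayProfile ν a U P) (hU3 : ContDiff ℝ 3 U) (hP2 : ContDiff ℝ 2 P)
    {b r₀ C R : ℝ} {N : ℕ} (hb : 0 ≤ b) (hba : b < a)
    (hUb : ∀ y, r₀ ≤ ‖y‖ → ‖U y‖ ≤ b * ‖y‖) (hPC : ∀ y, R ≤ ‖y‖ → |P y| ≤ C * ‖y‖ ^ N)
    {q : ℝ≥0∞} (hq1 : 1 ≤ q) (hq : q ≠ (⊤ : ℝ≥0∞)) (hUq : MemLp U q volume) : U = 0 := by
  have hU2 : ContDiff ℝ 2 U := hU3.of_le (by norm_num)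
  have hUc : Continuous U := hU2.continuous
  obtain ⟨M, hM0, hM⟩ := exists_affine_bound_of_eventually_le hUc hUb
  obtain ⟨C', hC'0, hC'⟩ := exists_poly_bound_of_eventually_le hP2.continuous hPC
  have hgrowth := abs_headPressure_le ha.le hb hM0 hC'0 hM hC'
  have hconst := isConst_of_driftOp_nonneg_of_poly hν hb hba (contDiff_headPressure hU2 hP2) hUc
    (h.driftOp_headPressure_nonneg_of_contDiff hν.le hU3 hP2) hUb hgrowth
  have hΔ : ∀ y, (Δ U) y = 0 := h.laplacian_eq_zero_of_headPressure_const_of_contDiff hν.ne' hU3 hP2 hconst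
  exact eq_zero_of_harmonic_memLp_inner (harmonicOnNhd_of_laplacian_eq_zero hU2 hΔ) hq1 hq hUq

end Endgame

/-! ## Tsai 1998, Theorems 1 and 2 from the lemmas of §§2–4 (named facts) and §5 (proved) -/

section Tsai1998

/-- **Tsai 1998, Theorem 1 from its lemmas** (p. 48, "Proofs of Theorems 1 and 2": "Lemmas 3.2
and 3.3 … give us the growth estimates `U(y) = o(|y|)`, `Π(y) = O(|y|^N)` … Lemma 5.1 then
implies that `Π` is constant … we get `−νΔUᵢ = 0` for each `i`. Since `U ∈ L^q(ℝ³)` in Theorem 1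
… the usual Liouville theorem implies that the `Uᵢ` are `0`"). The vendored Theorem 1
(`tsai_selfsimilar`: `3 < q < ∞`) follows from the regularity of profiles, Lemma 3.3 and
Lemma 3.2 (named facts) by the proved endgame `IsLerayProfile.eq_zero_of_growth` (with
`b = a/2`). [cite: Tsai1998, Theorem 1 and §5 (p. 48)] -/
theorem tsai_selfsimilar_of_growth_lemmas (hreg : tsai1998_profile_smooth) (h33 : tsai1998_lemma33)
    (h32 : tsai1998_lemma32) : tsai_selfsimilar := by
  intro ν a hν ha U P hprof q hq hq' hU
  have hU3 : ContDiff ℝ 3 U := contDiff_infty.1 (hreg hν ha hprof) 3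
  have hP2 : ContDiff ℝ 2 P := hprof.contDiff_two_pressure hU3
  obtain ⟨r₀, hr₀⟩ := h33 hν ha hprof hq hq' hU (a / 2) (half_pos ha)
  obtain ⟨N, C, R, hPR⟩ := h32 hν ha hprof hq.le hU
  have hq1 : 1 ≤ q := le_trans (by norm_num) hq.le
  exact hprof.eq_zero_of_growth hν ha hU3 hP2 (half_pos ha).le (half_lt_self ha) hr₀ hPR hq1
    hq'.ne hU

/-- **Tsai 1998, Theorem 2 from the lemmas** ("the first way", p. 47, combined with the
reduction of Theorem 1 above): the vendored `tsai_selfsimilar_local_energy` follows from the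
regularity of profiles, Lemmas 3.2, 3.3 (growth, named facts), Lemma 4.1 (suitability, named
fact) and Lemma 4.2 (backward ε-regularity, named fact), everything else — Corollary 4.3, the
covering argument at the top of the cylinder, (1.7), Lemma 5.1, the endgame and the harmonic
Liouville theorem — being proved in the tree. [cite: Tsai1998, Theorem 2 (p. 31) and its proof (p. 47)] -/
theorem tsai_selfsimilar_local_energy_of_growth_lemmas (hreg : tsai1998_profile_smooth)
    (h33 : tsai1998_lemma33) (h32 : tsai1998_lemma32) (h41 : tsai1998_lemma41)
    (h42 : tsai1998_lemma42) : tsai_selfsimilar_local_energy :=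
  tsai_selfsimilar_local_energy_of_lemmas (tsai_selfsimilar_of_growth_lemmas hreg h33 h32) h41 h42

/-- **Tsai 1998, Theorem 2 without Lemma 3.3** (p. 47: Corollary 4.3 already gives
`U(y) = O(|y|⁻¹)`, stronger than the growth `U(y) = o(|y|)` required by the endgame, and
`U ∈ L⁴(ℝ³)`): `tsai_selfsimilar_local_energy` follows from the regularity of profiles,
Lemma 3.2 (pressure growth), Lemma 4.1 and Lemma 4.2 alone. [cite: Tsai1998, proof of Theorem 2 (p. 47)] -/
theorem tsai_selfsimilar_local_energy_of_lemma32 (hreg : tsai1998_profile_smooth)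
    (h32 : tsai1998_lemma32) (h41 : tsai1998_lemma41) (h42 : tsai1998_lemma42) :
    tsai_selfsimilar_local_energy := by
  intro ν a T t₀ hν ha ht₀ U P hprof henergy hgrad
  obtain ⟨C, R, hdecay⟩ := tsai1998_corollary43 h41 (tsai1998_top_singular_null_of_lemma42 h42)
    hν ha ht₀ hprof henergy hgrad
  have hU4 : MemLp U 4 volume :=
    memLp_of_norm_mul_norm_le hprof.contDiff_velocity.continuous hdecay (by norm_num)
      ENNReal.ofNat_lt_top
  have hU3 : ContDiff ℝ 3 U := contDiff_infty.1 (hreg hν ha hprof) 3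
  have hP2 : ContDiff ℝ 2 P := hprof.contDiff_two_pressure hU3
  obtain ⟨N, C', R', hPR⟩ := h32 hν ha hprof (by norm_num) hU4
  -- `|y| |U(y)| ≤ C` for `|y| ≥ R` gives `|U(y)| ≤ (a/2)|y|` for `|y| ≥ max (max R 1) (2|C|/a)`
  have hUb : ∀ y : EuclideanSpace ℝ (Fin 3),
      max (max R 1) (2 * |C| / a) ≤ ‖y‖ → ‖U y‖ ≤ a / 2 * ‖y‖ := by
    intro y hy
    have hR : R ≤ ‖y‖ := le_trans (le_trans (le_max_left _ _) (le_max_left _ _)) hy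
    have h1 : 1 ≤ ‖y‖ := le_trans (le_trans (le_max_right _ _) (le_max_left _ _)) hy
    have h2 : 2 * |C| / a ≤ ‖y‖ := le_trans (le_max_right _ _) hy
    have h2' : 2 * |C| ≤ a * ‖y‖ := by rwa [div_le_iff₀' ha] at h2
    have hd : ‖y‖ * ‖U y‖ ≤ |C| := (hdecay y hR).trans (le_abs_self C)
    have h3 : ‖y‖ * ‖U y‖ ≤ ‖y‖ * (a / 2) := by nlinarith
    have h4 : ‖U y‖ ≤ a / 2 := le_of_mul_le_mul_left h3 (by linarith)
    nlinarith
  exact hprof.eq_zero_of_growth hν ha hU3 hP2 (half_pos ha).le (half_lt_self ha) hUb hPR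
    (by norm_num) ENNReal.ofNat_ne_top hU4

end Tsai1998

end Literature.Analysis.FluidPDE

end
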